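import Summits.QuantumAdvantage.QuantumAdvantage.Theses.ArithStatLadder
import Literature.Computability.Cryptography.HallgrenClassGroup
import Literature.Computability.Cryptography.ClassBQPProofs
import Literature.Computability.Cryptography.ShorProofs
import Literature.Computability.QuantumComplexity.BQPContainmentsProofs
import Literature.Computability.QuantumComplexity.CWrapAssembly
import Literature.Computability.Complexity.BrickAlgebra
import Literature.Computability.Complexity.BranchingFn
import Literature.Computability.Complexity.StackBricksArith
import Literature.Computability.Complexity.ZIntBricks
import Mathlib.Tactic.NormNum.LegendreSymbol

/-!
# Disproof of `IqThreeMemBQP` (crux `stmt-QuantumAdvantage-2424`, route ArithStatLadder) — findings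

Standing adversary file (cdisprove; cycle 1: refuter-cdisprove-stmt-QuantumAdvantage-2424-0, cycle 2: …-g2-0, 2026-08-16). Verdict so far: **NO KILL, and no unconditional kill is
available to present-day mathematics** — see §2: a proof of `¬ IqThreeMemBQP` is, inside the tree
and with the tree's PROVED sandwich `P ⊆ BPP ⊆ BQP ⊆ PP ⊆ PSPACE`, a proof of `BQP ≠ PSPACE`
(hence `P ≠ PSPACE`) modulo the folklore membership `IQ3 ∈ PSPACE` (count reduced forms of
discriminant `−d` in polynomial space). The crux is the GRH-conditional theorem of Hallgren 2005 /
Childs–van Dam 2010 §5.7 (tree fact `Hallgren2005_classNumber_qsolvable_of_GRH`, hypothesis-type)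
read through "decision from search"; unconditionally OPEN on the positive side as well (GRH-free
generation of `Cl(−d)`; Siegel-zero regime).

Findings, all `lean check`ed (rc 0, no sorry):

* §0 READING. `IqThreeMemBQP` is LITERALLY `iqThreeLang ∈ BQP` with
  `iqThreeLang = encodingNatBool.toLanguage {d | IsNegFundamentalDiscr d ∧ 3 ∣ h(−d)}`
  (`iqThreeMemBQP_iff`, by `Iff.rfl`; `IsNegFundamentalDiscr` of `HallgrenClassGroup.lean` is
  verbatim the inline disjunction). `toLanguage` is the IMAGE of Mathlib's `encodeNat` (LSB-first
  binary via `Num`, `encodeNat 0 = []`), so non-canonical words and `[]` lie OUTSIDE the language: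
  the deciding family must reject them (fine: classical syntax check; at input length `0` the
  tree's junk value `acceptProb = 0` on the empty register already rejects, `nil_not_mem`).
* §1 SMALL MODELS (the language is a genuine, nontrivial language — so neither the `∅`- nor the
  `univ`-shortcut applies, and the statement is not closed by the proved `P ⊆ BQP` for a silly
  reason): `3 ∉ S` (`h(−3) = 1`), `4 ∉ S` (`h(−4) = 1`), `23 ∈ S` (`h(−23) = 3`, the least
  element), `0 ∉ S`; hence `iqThreeLang ≠ 0` and `iqThreeLang ≠ Set.univ` (`lang_ne_zero`,
  `lang_ne_univ`). Class numbers by `decide` on the tree's `reducedForms` enumeration.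
* §2 BARRIER (why it resists): `not_mem_BPP_of_not`, `not_mem_P_of_not`,
  `BQP_ne_PSPACE_of_not`, `P_ne_PSPACE_of_not` — from `¬ IqThreeMemBQP` one gets `IQ3 ∉ BPP`,
  `IQ3 ∉ P` outright (tree theorems `BPP_subset_BQP_holds`, `P_subset_BQP_holds`), and
  `BQP ≠ PSPACE`, `P ≠ PSPACE` as soon as `IQ3 ∈ PSPACE` (folklore; the only non-constructed
  input, a poly-space reduced-form counter). So an unconditional refutation would be a
  super-polynomial uniform lower bound for an explicit `P^{#P}`-language against quantum (a
  fortiori classical) polynomial time — far beyond the state of the art; catalogued barrier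
  `Literature.Barriers.QuantumAdvantage.SeparationPrerequisites` is the same phenomenon one level up.
* §3 LOAD-BEARING ANALYSIS. The crux has NO hypotheses (atomic membership claim). Its implicit
  parameters — restriction to fundamental `−d`, the prime `3`, error `1/3`, P-uniformity,
  Clifford+T — were each mutated: every variant (all `d`; any prime `ℓ`; `EQP`; non-uniform
  `BQP/poly`; any finite universal gate set) is again a membership claim for a `PSPACE` language in
  a class containing `P`, hence equally unrefutable (§2 verbatim). Nothing is load-bearing for
  FALSITY; for TRUTH the load-bearing input is a poly(log d) generating set of `Cl(−d)` (Bach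
  `6 log² d` under GRH; unconditionally only Minkowski/Burgess-type `d^{θ}` bounds) — recorded for
  the provers, not formalisable as a refutation.
* §4 NATURAL STRENGTHENINGS. (a) `EQP`-version, (b) `IQ3 ∈ P`, (c) `IQ3 ∈ BPP`: none refutable
  (each refutation ⇒ `P ≠ PSPACE` modulo `IQ3 ∈ PSPACE`, same proof as §2). (d) The
  over-optimistic generation bound "prime forms of norm `≤ log₂ d` generate `Cl(−d)`" IS false
  — witness `d = 547`, formalised at the level of forms in §4bis (a remark on the MECHANISM, not on
  the crux).
* §4bis NUMERICAL WITNESS for the GRH-free generation obstruction: `d = 547 ∈ S` (`h(−547) = 3`,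
  `classNumber_neg_547` by `decide`), all primes `≤ ⌊log₂ 547⌋ = 9` inert (`inert_below_log2_547`,
  Jacobi symbols by `norm_num`) and no form of discriminant `−547` has `2 ≤ a ≤ 9`
  (`no_small_form_547`, residues in `ZMod (4a)` by `decide`): prime forms of norm `≤ log₂|D|` need
  not generate `Cl(D)` — the Bach-type constant cannot be pushed to `log₂`.
* §5 Targets: none yet (payload.targets / stuck_stubs empty at cycles 1–2; no line picked).
* §6 (CYCLE 2) THE SEARCH-TO-DECISION GLUE IS BROKEN AS TYPED — and repaired. The vendored fact
  `Hallgren2005_classNumber_qsolvable_of_GRH` writes `encodeNat (h(−d))` as a BARE PREFIX of the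
  measured string; `encodeNat` is not prefix-free (`bin 1 = [true] <+: [true,true] = bin 3`) and a
  candidate class number cannot be verified, so by `IsQSolvable.mono` the fact's conclusion for the
  true `h` implies the same conclusion for `h' = (if h = 3 then 1 else h)`, which FLIPS `3 ∣ ·` at
  `d = 23` (`hallgrenFact_collapse`, `hallgrenFact_underdetermines_threeDvd`). Hence the conditional
  support `GRH → IqThreeMemBQP` that the route file, the grounder and cycle 1 of this file all describe
  as "fact ∘ decision-from-search" does NOT go through with the fact as typed (this corrects cycle 1's
  recommendation). Repair = the tree's own `_delim` convention (`Hallgren2007_regulator_qsolvable_delim`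
  records the identical pitfall for the regulator): output `y = boolPair (encodeNat h) w`. PROVED here:
  delim ⇒ plain (`hallgrenFact_of_delim`, a harmless strengthening — the Kitaev/Hallgren proof
  programme's read-out `clOrderEst` is exact) and delim ⇒ the one-bit relation `[3 ∣ h(−d)]` is
  `IsQSolvable` (`threeDvdBit_qsolvable_of_delim`: classical wrap with the `FP` post-processor
  `isNilFn ∘ remFn ∘ fanoutFn (fstF ∘ sndF) (const (bin 3))`); with the guard dropped as well
  (`HallgrenClassNumberDelimTotal`, proposed re-typing) the bit relation is TOTAL
  (`threeDvdBit_total_of_total`) and `mem_BQP_of_isQSolvable_bit` applies. Landed copy: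
  `Theorems/IqThreeMemBQP/Negative/SearchOutputPrefix.lean`. The SAME pitfall sits in the idea cards'
  quantum stubs: mirror-dodge K3 `RealQuadraticPrimeClassOrderQSolvable` (`Ideator2Sketch.lean`:
  `encodeNat (orderOf [𝔭]) <+: y`; on the REAL side a candidate order cannot be verified without a
  principal-ideal test, so T3's "`3 ∣ ord`" is unreadable from it) and the shared crux
  `DarkClassGroups.AbelianGroupOrderFBQP` (stmt-3193: `encodeNat |⟨gs⟩| <+: y`). Formal: `K3Collapsed_of_K3Typed`
  (verbatim copy of K3 ⇒ the same with `ord ↦ if ord = 3 then 1 else ord`), and the usable re-typings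
  `K3Delim ⇒ K3Bit` (proved). Generic lemma: `isQSolvable_guardedPrefix_mono(_forall)`. RECOMMENDATION to crux-plan / lead / literature: type every
  order / class-number primitive SELF-DELIMITED (`boolPair`) or as the needed BIT (`[3 ∣ ord]`), and
  unguarded where the junk branch is classically printable.
* §7 (CYCLE 2) LINE-LEVEL NOTES for the merged mirror line (scholz-mirror-siegel ≈ mirror-dodge ≈
  scholz-mirror-landau-page; engines bright-sampler-meter ≈ torsion-witness-sampling; all passed by
  the triage panel): K2 numerics (escape fraction → 2/3 from above, ≥ 5/9 from `x = 10³` on, sixteen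
  `h = 3` fields); load-bearing map (K1/K3/K4 bite only on dark `d`, which cannot be exhibited ⇒ no
  `_false_without_` theorem exists for them; K2 everywhere); the glue checklist (two quantum subroutines
  per input ⇒ one missing `BQP ∩ BQP` combinator); my re-checks of the typed first lemmas (no kill).

What the PROVERS should take from this file: the item is TRUE-but-unprovable-today as typed
(unconditional) along every GRH-type route; the mirror line of the idea cards is a credible GRH-FREE
strategy at print level (no cheap kill found, §7), formally XL (class field theory for K1, a 2-dim
continuous HSP for K3). The deliverable within reach is the conditional
`GrandRiemannHypothesisGL → IqThreeMemBQP` — but NOT as "`Hallgren2005_classNumber_qsolvable_of_GRH` ∘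
decision-from-search" with the fact as typed (§6: a bare-prefix output is ambiguous); it needs the
SELF-DELIMITED, unguarded re-typing of the fact, after which the quantum core is PROVED here
(`threeDvdBit_total_of_total`) and what remains is the fundamentality test
(`isQSolvable_factoring_holds`) plus ONE intersection combinator, over the uniform-family composition
API of route Shor (§7 (c)).
Model facts they will hit: acceptance is read on INPUT wire `0` (so even rejecting everything
needs a gate or the `n + m = 0` junk), `[]` and words with a trailing `false` are outside the
language, amplification `BQP_eq_BQPWith` and `co_BQP` are available in the tree.
-/

noncomputable section

set_option linter.dupNamespace false

namespace Summit.QuantumAdvantage.QuantumAdvantage.Cruxes.IqThreeMemBQP.Disproof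

open _root_.Computability Literature.Computability.Complexity Literature.Computability.Complexity.Classes
open Literature.Computability.Cryptography Literature.Computability.QuantumComplexity
open Literature.NumberTheory.QuadraticFields
open Summit.QuantumAdvantage.QuantumAdvantage.Theses.ArithStatLadder

/-! ### §0 Reading of the statement -/

/-- The set `S = {d : −d fundamental, 3 ∣ h(−d)}` of the crux (with `IsNegFundamentalDiscr`, which is
verbatim the route file's inline disjunction). [folklore] -/
def iqThreeSet : Set ℕ :=
  {d | IsNegFundamentalDiscr d ∧ 3 ∣ BinaryQuadraticForm.classNumber (-(d : ℤ))}

/-- The language `IQ3 = bin(S)` (image of Mathlib's `encodeNat`, LSB first). [folklore] -/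
def iqThreeLang : Language Bool :=
  encodingNatBool.toLanguage iqThreeSet

/-- The crux is literally `IQ3 ∈ BQP` (definitional). [folklore] -/
theorem iqThreeMemBQP_iff : IqThreeMemBQP ↔ iqThreeLang ∈ BQP := Iff.rfl

/-- Membership in the language of an encoded number is membership in `S`. [folklore] -/
theorem encodeNat_mem_iff (d : ℕ) : encodeNat d ∈ iqThreeLang ↔ d ∈ iqThreeSet :=
  encodingNatBool.mem_toLanguage_iff iqThreeSet d

/-! ### §1 Small models: the language is nontrivial -/

/-- `h(−3) = 1`. [folklore] -/
theorem classNumber_neg_three : BinaryQuadraticForm.classNumber (-3) = 1 := by decide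

/-- `h(−4) = 1`. [folklore] -/
theorem classNumber_neg_four : BinaryQuadraticForm.classNumber (-4) = 1 := by decide

/-- `h(−23) = 3` (the least fundamental discriminant with `3 ∣ h`). [folklore] -/
theorem classNumber_neg_twentythree : BinaryQuadraticForm.classNumber (-23) = 3 := by decide

/-- `0 ∉ S` (`0` is not a fundamental discriminant). [folklore] -/
theorem zero_not_mem : 0 ∉ iqThreeSet := by
  rintro ⟨h, -⟩
  rcases h with ⟨h1, -, -⟩ | ⟨-, h2, -⟩
  · norm_num at h1
  · norm_num at h2

/-- `3 ∉ S`: `−3` is fundamental but `h(−3) = 1`. [folklore] -/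
theorem three_not_mem : 3 ∉ iqThreeSet := by
  rintro ⟨-, h⟩
  rw [show (-(((3 : ℕ)) : ℤ)) = -3 by norm_num, classNumber_neg_three] at h
  omega

/-- `4 ∉ S`: `−4` is fundamental but `h(−4) = 1`. [folklore] -/
theorem four_not_mem : 4 ∉ iqThreeSet := by
  rintro ⟨-, h⟩
  rw [show (-(((4 : ℕ)) : ℤ)) = -4 by norm_num, classNumber_neg_four] at h
  omega

/-- `23 ∈ S`: `−23 ≡ 1 (mod 4)` is squarefree (prime) and `h(−23) = 3`. [folklore] -/
theorem twentythree_mem : 23 ∈ iqThreeSet := by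
  refine ⟨Or.inl ⟨by decide, ?_, by decide⟩, ?_⟩
  · have h23 : Prime (-23 : ℤ) := Int.prime_iff_natAbs_prime.2 (by norm_num)
    exact_mod_cast h23.squarefree
  · rw [show (-(((23 : ℕ)) : ℤ)) = -23 by norm_num, classNumber_neg_twentythree]

/-- The empty word is not in `IQ3` (it encodes `0`). So at input length `0` the deciding family
must reject — which the tree's junk value `acceptProb = 0` on the empty register does for free.
[folklore] -/
theorem nil_not_mem : ([] : List Bool) ∉ iqThreeLang := by
  rintro ⟨d, hd, hd0⟩
  change encodeNat d = [] at hd0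
  have h := congrArg decodeNat hd0
  rw [decode_encodeNat] at h
  have h0 : d = 0 := h.trans (by decide)
  subst h0
  exact zero_not_mem hd

/-- `IQ3 ≠ ∅` (as a language, `0 = ∅`). [folklore] -/
theorem lang_ne_zero : iqThreeLang ≠ 0 := by
  intro h
  have h23 : encodeNat 23 ∈ iqThreeLang := (encodeNat_mem_iff 23).2 twentythree_mem
  rw [h] at h23
  exact h23

/-- `IQ3 ≠ {0,1}*`. [folklore] -/
theorem lang_ne_univ : iqThreeLang ≠ (Set.univ : Set (List Bool)) := by
  intro h
  have h3 : encodeNat 3 ∉ iqThreeLang := fun hm => three_not_mem ((encodeNat_mem_iff 3).1 hm)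
  rw [h] at h3
  exact h3 (Set.mem_univ _)

/-! ### §2 Barrier: what a refutation would cost -/

/-- A refutation of the crux puts `IQ3` outside `BPP` (tree theorem `BPP ⊆ BQP`). [folklore] -/
theorem not_mem_BPP_of_not (h : ¬ IqThreeMemBQP) : iqThreeLang ∉ BPP :=
  fun hB => h (BPP_subset_BQP_holds hB)

/-- A refutation of the crux puts `IQ3` outside `P` (tree theorem `P ⊆ BQP`). [folklore] -/
theorem not_mem_P_of_not (h : ¬ IqThreeMemBQP) : iqThreeLang ∉ P :=
  fun hP => h (P_subset_BQP_holds hP)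

/-- A refutation of the crux, together with the folklore `IQ3 ∈ PSPACE` (poly-space count of
reduced forms), separates `BQP` from `PSPACE`. [folklore] -/
theorem BQP_ne_PSPACE_of_not (h : ¬ IqThreeMemBQP) (hS : iqThreeLang ∈ PSPACE) : BQP ≠ PSPACE :=
  fun hEq => h (iqThreeMemBQP_iff.2 (hEq ▸ hS))

/-- … and hence `P ≠ PSPACE` (tree theorem `P ⊆ BQP`). [folklore] -/
theorem P_ne_PSPACE_of_not (h : ¬ IqThreeMemBQP) (hS : iqThreeLang ∈ PSPACE) : P ≠ PSPACE :=
  fun hEq => not_mem_P_of_not h (hEq ▸ hS)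

/-- Contrapositive packaging: if `P = PSPACE` (not refuted!) and `IQ3 ∈ PSPACE`, the crux HOLDS —
so no argument available today can refute it. [folklore] -/
theorem iqThreeMemBQP_of_P_eq_PSPACE (hEq : P = PSPACE) (hS : iqThreeLang ∈ PSPACE) :
    IqThreeMemBQP :=
  iqThreeMemBQP_iff.2 (P_subset_BQP_holds (hEq ▸ hS))

/-! ### §4bis A numerical witness for the GRH-free generation obstruction (`d = 547`)

The unconditional PROOF strategies in print all need a small generating set of `Cl(−d)` (prime forms
of norm `≤ B(d)`, `B = 6 log² d` under GRH). The cheapest conceivable bound `B = log₂ d` already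
FAILS: for `d = 547` (prime, `≡ 3 (mod 8)`), `h(−547) = 3`, so `547 ∈ S` and `Cl(−547) ≅ ℤ/3`
(reduced forms `(1, 1, 137)`, `(11, ±5, 13)`), but EVERY prime `p ≤ 9 = ⌊log₂ 547⌋` is inert
(`547 ≡ 3 (mod 8)`; Jacobi symbols `(−547/p) = −1` for `p = 3, 5, 7`), and in fact no form of
discriminant `−547` at all has leading coefficient `2 ≤ a ≤ 9` (`no_small_form_547`): the prime
forms of norm `≤ log₂|D|` generate only the trivial subgroup. (The least split prime is `11`.)
A data point on the MECHANISM (constants in Bach-type bounds), not on the crux. -/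

set_option maxHeartbeats 4000000 in
set_option maxRecDepth 100000 in
/-- `h(−547) = 3` (kernel `decide` on the tree's reduced-form enumeration, ~10⁵ candidate pairs;
about a minute of kernel time, hence the raised limits). [folklore] -/
theorem classNumber_neg_547 : BinaryQuadraticForm.classNumber (-547) = 3 := by
  decide

/-- `547 ∈ S`: `−547 ≡ 1 (mod 4)` is squarefree (prime) and `3 ∣ h(−547) = 3`. [folklore] -/
theorem mem_547 : 547 ∈ iqThreeSet := by
  refine ⟨Or.inl ⟨by decide, ?_, by decide⟩, ?_⟩
  · have hp : Prime (-547 : ℤ) := Int.prime_iff_natAbs_prime.2 (by norm_num)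
    exact_mod_cast hp.squarefree
  · rw [show (-(((547 : ℕ)) : ℤ)) = -547 by norm_num, classNumber_neg_547]

/-- `⌊log₂ 547⌋ = 9`, `547` is a prime `≡ 3 (mod 8)` (so `2` is inert in `ℚ(√−547)`), and the odd
primes `≤ 9` are inert: `(−547/3) = (−547/5) = (−547/7) = −1`. [folklore] -/
theorem inert_below_log2_547 :
    2 ^ 9 ≤ 547 ∧ 547 < 2 ^ 10 ∧ Nat.Prime 547 ∧ 547 % 8 = 3 ∧
      jacobiSym (-547) 3 = -1 ∧ jacobiSym (-547) 5 = -1 ∧ jacobiSym (-547) 7 = -1 := by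
  norm_num

/-- No binary quadratic form of discriminant `−547` has leading coefficient `2 ≤ a ≤ 9`; in
particular there is no prime form of norm `≤ ⌊log₂ 547⌋`, although `Cl(−547) ≅ ℤ/3` is
nontrivial. (Residues: `b² ≢ −547 (mod 4a)` for `a = 2, …, 9`, by `decide` in `ZMod (4a)`.)
[folklore] -/
theorem no_small_form_547 : ∀ a b c : ℤ, b ^ 2 - 4 * a * c = -547 → 2 ≤ a → a ≤ 9 → False := by
  intro a b c h h2 h9
  interval_cases a
  · have key : ∀ x y : ZMod 8, x ^ 2 - 4 * 2 * y ≠ -547 := by decide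
    have h' := congrArg (Int.cast : ℤ → ZMod 8) h
    push_cast at h'
    exact key _ _ h'
  · have key : ∀ x y : ZMod 12, x ^ 2 - 4 * 3 * y ≠ -547 := by decide
    have h' := congrArg (Int.cast : ℤ → ZMod 12) h
    push_cast at h'
    exact key _ _ h'
  · have key : ∀ x y : ZMod 16, x ^ 2 - 4 * 4 * y ≠ -547 := by decide
    have h' := congrArg (Int.cast : ℤ → ZMod 16) h
    push_cast at h'
    exact key _ _ h'
  · have key : ∀ x y : ZMod 20, x ^ 2 - 4 * 5 * y ≠ -547 := by decide
    have h' := congrArg (Int.cast : ℤ → ZMod 20) h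
    push_cast at h'
    exact key _ _ h'
  · have key : ∀ x y : ZMod 24, x ^ 2 - 4 * 6 * y ≠ -547 := by decide
    have h' := congrArg (Int.cast : ℤ → ZMod 24) h
    push_cast at h'
    exact key _ _ h'
  · have key : ∀ x y : ZMod 28, x ^ 2 - 4 * 7 * y ≠ -547 := by decide
    have h' := congrArg (Int.cast : ℤ → ZMod 28) h
    push_cast at h'
    exact key _ _ h'
  · have key : ∀ x y : ZMod 32, x ^ 2 - 4 * 8 * y ≠ -547 := by decide
    have h' := congrArg (Int.cast : ℤ → ZMod 32) h
    push_cast at h'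
    exact key _ _ h'
  · have key : ∀ x y : ZMod 36, x ^ 2 - 4 * 9 * y ≠ -547 := by decide
    have h' := congrArg (Int.cast : ℤ → ZMod 36) h
    push_cast at h'
    exact key _ _ h'

/-! ### §3 Load-bearing analysis (prose; nothing to formalise)

The crux is an atomic membership claim without hypotheses. Mutations tried (each is again
"an explicit `PSPACE` language lies in a class containing `P`", so §2 applies verbatim and NO
variant is refutable today):
* drop fundamentality (`{d | 3 ∣ h(−d)}`; NB the tree's `h(D) = #reducedForms D = 0` for
  `D ≢ 0, 1 (mod 4)`, and `3 ∣ 0`, so every `d ≡ 1, 2 (mod 4)` would be IN — a different but still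
  `PSPACE` language);
* replace `3` by another prime `ℓ`: same. Side remark for planners: `ℓ = 2` is CLASSICAL — by
  genus theory the 2-rank of `Cl(D)` is `ω(|D|) − 1` for fundamental `D < 0`, so
  `2 ∣ h(−d) ↔ |D|` has two distinct prime factors; together with the fundamentality test this is
  in `BPP^{FACTORING} ⊆ BQP` (Shor), and even the non-fundamental part "is `d` a prime power" is in
  `P` (AKS on integer roots). The choice `ℓ = 3` is exactly what makes the witness
  factoring-independent (no genus theory at `3`), as the route says — and what makes the classical
  side plausibly hard; it changes nothing on the refutation side;
* `EQP` instead of `BQP`, or `BPP`, or `P` as the target class: unrefutable alike (each contains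
  `P`; each refutation ⇒ `P ≠ PSPACE` modulo `IQ3 ∈ PSPACE`);
* non-uniform families (`BQP/poly`): weaker claim, a fortiori unrefutable;
* another finite universal gate set: same class by Solovay–Kitaev (tree fact `BQPOver_eq_BQP`).

Load-bearing for TRUTH (prover information, not refutation material): a `poly(log d)`-size
generating set of `Cl(−d)` reachable by a uniform family — Bach's `6 log² d` under GRH; without
GRH only exponential (`d^θ`) bounds for the least split prime are known (Burgess), and random
sampling of reduced forms has acceptance governed by `L(1, χ_{−d})`, uncontrolled in the
Siegel-zero regime.

### §4 Natural strengthenings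

* "`Cl(−d)` is generated by prime forms of norm `≤ log₂ d`" — FALSE: `d = 547` (§4bis:
  `h(−547) = 3`, every prime `≤ 9 = ⌊log₂ 547⌋` inert, no form with `2 ≤ a ≤ 9`; the family
  "prime `d ≡ 3 (mod 8)`, `d > 163`, all odd `p ≤ log₂ d` inert" gives infinitely many more:
  `883, 907, 4027, …` with `3 ∣ h`). It only says the constant in a Bach-type bound cannot be
  pushed to `log₂ d`; the printed GRH bound is `6 log² d` (Bach 1990), and unconditionally only
  `d^{1/4√e+ε}`-type bounds (Burgess) are known for the least split prime — the real obstruction to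
  an unconditional PROOF, irrelevant to refutation.
* "`IQ3 ∈ BQP` with zero error and zero ancillas" etc.: artificial, not pursued.

### §5 Targets (lead's stuck stubs)

None at cycle 1 (`payload.targets = []`, `stuck_stubs = []`).
-/

/-! ### §6 (cycle 2) The search-to-decision glue: bare binary prefixes are ambiguous

The vendored fact `Hallgren2005_classNumber_qsolvable_of_GRH` (the only source of a near-term,
GRH-conditional proof of the crux) asks the family to write `encodeNat (h(−d))` as a BARE PREFIX of the
measured string. `encodeNat` is not prefix-free and a candidate class number cannot be verified, so the
conclusion does not determine `3 ∣ h(−d)`: formally, it is inherited by the wrong function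
`h' = (if h = 3 then 1 else h)` (monotonicity of `IsQSolvable`), which disagrees with `h` on `3 ∣ ·` at
`d = 23`. Repair: the tree's `_delim` convention (`y = boolPair (encodeNat h) w`, cf.
`Hallgren2007_regulator_qsolvable_delim`), which implies the plain fact and DOES yield the decision bit.
The same applies to every "order as a bare prefix" stub of the idea cards (mirror-dodge K3,
`RealQuadraticPrimeClassOrderQSolvable`; DarkClassGroups' `AbelianGroupOrderFBQP`). Landed copy:
`Theorems/IqThreeMemBQP/Negative/SearchOutputPrefix.lean`. -/

section SearchOutputPrefix

open scoped nonZeroDivisors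
open Literature.Computability.Complexity.Brick Literature.NumberTheory.LFunctions NumberField

/-- `bin 1 = [true]` is a prefix of `bin 3 = [true, true]`, although `3 ∤ 1`, `3 ∣ 3`. [folklore] -/
theorem encodeNat_one_isPrefix_encodeNat_three : encodeNat 1 <+: encodeNat 3 ∧ ¬ 3 ∣ 1 ∧ 3 ∣ 3 := by
  decide

/-- Guarded-prefix relations only see the answer up to prefix-collapse: if `g x <+: f x` always, a
solver for "under promise `P x` output `f x` as a prefix" also solves the problem for `g`.
[folklore] -/
theorem isQSolvable_guardedPrefix_mono {P : List Bool → Prop} {f g : List Bool → List Bool}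
    (hfg : ∀ x, g x <+: f x) (h : IsQSolvable fun x => {y | P x → f x <+: y}) :
    IsQSolvable fun x => {y | P x → g x <+: y} :=
  h.mono fun x _ hy hP => (hfg x).trans (hy hP)

/-- Indexed form (the shape of `RealQuadraticPrimeClassOrderQSolvable`-type stubs). [folklore] -/
theorem isQSolvable_guardedPrefix_mono_forall {ι : Sort*} {P : List Bool → ι → Prop}
    {f g : List Bool → ι → List Bool} (hfg : ∀ x i, g x i <+: f x i)
    (h : IsQSolvable fun x => {y | ∀ i, P x i → f x i <+: y}) :
    IsQSolvable fun x => {y | ∀ i, P x i → g x i <+: y} :=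
  h.mono fun x _ hy i hP => (hfg x i).trans (hy i hP)

/-- The collapse `3 ↦ 1` shortens binary codes to a prefix. [folklore] -/
theorem encodeNat_collapse_isPrefix (n : ℕ) : encodeNat (if n = 3 then 1 else n) <+: encodeNat n := by
  split_ifs with h
  · subst h
    decide
  · exact List.prefix_rfl

/-- **The vendored Hallgren fact does not pin `3 ∣ h`**: its conclusion for the true class number
implies the same conclusion for `h' = (if h = 3 then 1 else h)`. [folklore] -/
theorem hallgrenFact_collapse (hH : Hallgren2005_classNumber_qsolvable_of_GRH)
    (hG : GrandRiemannHypothesisGL) :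
    IsQSolvable fun x : List Bool =>
      {y | IsNegFundamentalDiscr (decodeNat x) →
        encodeNat (if BinaryQuadraticForm.classNumber (-(decodeNat x : ℤ)) = 3 then 1
          else BinaryQuadraticForm.classNumber (-(decodeNat x : ℤ))) <+: y} :=
  isQSolvable_guardedPrefix_mono (P := fun x => IsNegFundamentalDiscr (decodeNat x))
    (f := fun x => encodeNat (BinaryQuadraticForm.classNumber (-(decodeNat x : ℤ))))
    (g := fun x => encodeNat (if BinaryQuadraticForm.classNumber (-(decodeNat x : ℤ)) = 3 then 1
      else BinaryQuadraticForm.classNumber (-(decodeNat x : ℤ))))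
    (fun _ => encodeNat_collapse_isPrefix _) (hH hG)

/-- **Packaged**: a function `g` on which the fact's conclusion also holds (given the fact and GRH)
but which gets `3`-divisibility wrong at the fundamental discriminant `−23` (`h(−23) = 3`, `g(−23) = 1`).
So `GRH → IQ3 ∈ BQP` is not a consequence of the fact AS TYPED by any argument uniform in the
class-number function — in particular not by "read `h` off the output, test `3 ∣ h`". [folklore] -/
theorem hallgrenFact_underdetermines_threeDvd :
    ∃ g : ℤ → ℕ,
      (Hallgren2005_classNumber_qsolvable_of_GRH → GrandRiemannHypothesisGL →
        IsQSolvable fun x : List Bool =>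
          {y | IsNegFundamentalDiscr (decodeNat x) → encodeNat (g (-(decodeNat x : ℤ))) <+: y}) ∧
      IsNegFundamentalDiscr 23 ∧ 3 ∣ BinaryQuadraticForm.classNumber (-23) ∧ ¬ 3 ∣ g (-23) := by
  refine ⟨fun D => if BinaryQuadraticForm.classNumber D = 3 then 1 else BinaryQuadraticForm.classNumber D,
    fun hH hG => hallgrenFact_collapse hH hG, ?_, ?_, ?_⟩
  · left
    refine ⟨by decide, ?_, by decide⟩
    have h23 : Prime (-23 : ℤ) := Int.prime_iff_natAbs_prime.2 (by norm_num)
    exact h23.squarefree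
  · rw [classNumber_neg_twentythree]
  · simp only [classNumber_neg_twentythree, if_true]
    decide

/-- **Self-delimited ⇒ plain** (the re-typing is a harmless strengthening; proof as
`Hallgren2007_regulator_qsolvable_of_delim`: classical wrap with `fstF ∘ sndF ∈ FP`). [folklore] -/
theorem hallgrenFact_of_delim
    (hdelim : GrandRiemannHypothesisGL →
      IsQSolvable fun x : List Bool =>
        {y | IsNegFundamentalDiscr (decodeNat x) →
          ∃ w : List Bool,
            y = boolPair (encodeNat (BinaryQuadraticForm.classNumber (-(decodeNat x : ℤ)))) w}) :
    Hallgren2005_classNumber_qsolvable_of_GRH := by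
  intro hG
  have hwrap := isQSolvable_classicalWrap_holds (fun x => x) (fstF ∘ sndF)
    (PolyTimeComputable.id _) (comp_mem_FP fstF_mem_FP sndF_mem_FP) (hdelim hG)
  refine hwrap.mono fun x z hz => ?_
  simp only [Set.mem_setOf_eq] at hz ⊢
  obtain ⟨y, hy, hpre⟩ := hz
  intro hfund
  obtain ⟨w, rfl⟩ := hy hfund
  have hg : (fstF ∘ sndF) (boolPair x (boolPair
      (encodeNat (BinaryQuadraticForm.classNumber (-(decodeNat x : ℤ)))) w)) =
      encodeNat (BinaryQuadraticForm.classNumber (-(decodeNat x : ℤ))) := by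
    simp [Function.comp]
  rw [hg] at hpre
  exact hpre

/-- The `FP` post-processor reading the bit `[3 ∣ m]` off `⟨x, boolPair (bin m) w⟩` is polynomial
time. [folklore] -/
theorem threeDvdPost_mem_FP :
    (isNilFn ∘ remFn ∘ fanoutFn (fstF ∘ sndF) (fun _ => encodeNat 3)) ∈ FP :=
  comp_mem_FP isNilFn_mem_FP
    (comp_mem_FP remFn_mem_FP
      (fanoutFn_mem_FP (comp_mem_FP fstF_mem_FP sndF_mem_FP) (const_mem_FP _)))

/-- … and computes `[decide (3 ∣ m)]`. [folklore] -/
theorem threeDvdPost_apply (x w : List Bool) (m : ℕ) :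
    (isNilFn ∘ remFn ∘ fanoutFn (fstF ∘ sndF) (fun _ => encodeNat 3))
      (boolPair x (boolPair (encodeNat m) w)) = [decide (3 ∣ m)] := by
  simp only [Function.comp_apply, fanoutFn_apply, sndF_boolPair, fstF_boolPair, remFn_boolPair,
    bitsToNat_encodeNat, isNilFn, encodeNat_eq_nil_iff]
  simp only [Nat.dvd_iff_mod_eq_zero]

/-- **Self-delimited ⇒ the decision bit**: under GRH the one-bit search problem "on a negative
fundamental discriminant `−d`, write `[3 ∣ h(−d)]` on wire `0`" is `IsQSolvable` — the quantum core of
`GRH → IqThreeMemBQP`; the rest is language-level bookkeeping (§7 (c)). [folklore] -/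
theorem threeDvdBit_qsolvable_of_delim
    (hdelim : GrandRiemannHypothesisGL →
      IsQSolvable fun x : List Bool =>
        {y | IsNegFundamentalDiscr (decodeNat x) →
          ∃ w : List Bool,
            y = boolPair (encodeNat (BinaryQuadraticForm.classNumber (-(decodeNat x : ℤ)))) w})
    (hG : GrandRiemannHypothesisGL) :
    IsQSolvable fun x : List Bool =>
      {z | IsNegFundamentalDiscr (decodeNat x) →
        [decide (3 ∣ BinaryQuadraticForm.classNumber (-(decodeNat x : ℤ)))] <+: z} := by
  have hwrap := isQSolvable_classicalWrap_holds (fun x => x)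
    (isNilFn ∘ remFn ∘ fanoutFn (fstF ∘ sndF) (fun _ => encodeNat 3))
    (PolyTimeComputable.id _) threeDvdPost_mem_FP (hdelim hG)
  refine hwrap.mono fun x z hz => ?_
  simp only [Set.mem_setOf_eq] at hz ⊢
  obtain ⟨y, hy, hpre⟩ := hz
  intro hfund
  obtain ⟨w, rfl⟩ := hy hfund
  rwa [threeDvdPost_apply] at hpre

/-- PROPOSED re-typing of the vendored fact (for the literature role / planner; NOT a tree fact):
self-delimited AND unguarded — every input, the class number of `−(decodeNat x)` in the tree's sense
(for `−d` not a discriminant the tree's `classNumber` is a classical junk value the family can print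
itself). With this form the bit relation of `threeDvdBit_qsolvable_of_delim` becomes TOTAL and
`mem_BQP_of_isQSolvable_bit` applies directly to `{x | 3 ∣ h(−decodeNat x)}`. [folklore] -/
def HallgrenClassNumberDelimTotal : Prop :=
  GrandRiemannHypothesisGL →
    IsQSolvable fun x : List Bool =>
      {y | ∃ w : List Bool,
        y = boolPair (encodeNat (BinaryQuadraticForm.classNumber (-(decodeNat x : ℤ)))) w}

/-- The unguarded self-delimited form implies the guarded one (hence, by `hallgrenFact_of_delim`, the
vendored fact). [folklore] -/
theorem hallgrenDelim_of_total (h : HallgrenClassNumberDelimTotal) :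
    GrandRiemannHypothesisGL →
      IsQSolvable fun x : List Bool =>
        {y | IsNegFundamentalDiscr (decodeNat x) →
          ∃ w : List Bool,
            y = boolPair (encodeNat (BinaryQuadraticForm.classNumber (-(decodeNat x : ℤ)))) w} :=
  fun hG => (h hG).mono fun _ _ hy _ => hy

/-- … and yields the TOTAL bit relation `x ↦ {z | [3 ∣ h(−decodeNat x)] <+: z}` (no promise), the
exact hypothesis shape of `mem_BQP_of_isQSolvable_bit` for the language `{x | 3 ∣ h(−decodeNat x)}`.
[folklore] -/
theorem threeDvdBit_total_of_total (h : HallgrenClassNumberDelimTotal) (hG : GrandRiemannHypothesisGL) :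
    IsQSolvable fun x : List Bool =>
      {z | [decide (3 ∣ BinaryQuadraticForm.classNumber (-(decodeNat x : ℤ)))] <+: z} := by
  have hwrap := isQSolvable_classicalWrap_holds (fun x => x)
    (isNilFn ∘ remFn ∘ fanoutFn (fstF ∘ sndF) (fun _ => encodeNat 3))
    (PolyTimeComputable.id _) threeDvdPost_mem_FP (h hG)
  refine hwrap.mono fun x z hz => ?_
  simp only [Set.mem_setOf_eq] at hz ⊢
  obtain ⟨y, ⟨w, rfl⟩, hpre⟩ := hz
  rwa [threeDvdPost_apply] at hpre

/-! #### The same pitfall in the idea cards' real-side primitive (mirror-dodge K3)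

`RealQuadraticPrimeClassOrderQSolvable` of `Ideator2Sketch.lean` outputs `encodeNat (ord [𝔭]) <+: y`; on the
real side a candidate order cannot be verified without a principal-ideal test, so the mirror triple
test's T3 ("`3 ∣ ord`") cannot be read off it. Verbatim copy, its collapse, and the two usable
re-typings (self-delimited / bit), the former implying the latter. -/

/-- K3 of mirror-dodge, copied verbatim from `Ideator2Sketch.lean`
(`MirrorDodge.RealQuadraticPrimeClassOrderQSolvable`). [this work: copy for analysis] -/
def K3Typed : Prop :=
  IsQSolvable fun x : List Bool =>
    {y | ∀ (F : Type) [Field F] [NumberField F] (D p r : ℕ) (α : 𝓞 F),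
      x = boolPair (encodeNat D) (boolPair (encodeNat p) (encodeNat r)) →
        Squarefree D → 2 ≤ D → Module.finrank ℚ F = 2 → (α : F) ^ 2 = (D : F) → p.Prime →
          (p : ℤ) ∣ (r : ℤ) ^ 2 - D →
            ∀ hI : Ideal.span {(p : 𝓞 F), (r : 𝓞 F) + α} ∈ (Ideal (𝓞 F))⁰,
              encodeNat (orderOf (ClassGroup.mk0 ⟨_, hI⟩)) <+: y}

/-- The same statement for the WRONG order function `ord' = (if ord = 3 then 1 else ord)`. [folklore] -/
def K3Collapsed : Prop :=
  IsQSolvable fun x : List Bool =>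
    {y | ∀ (F : Type) [Field F] [NumberField F] (D p r : ℕ) (α : 𝓞 F),
      x = boolPair (encodeNat D) (boolPair (encodeNat p) (encodeNat r)) →
        Squarefree D → 2 ≤ D → Module.finrank ℚ F = 2 → (α : F) ^ 2 = (D : F) → p.Prime →
          (p : ℤ) ∣ (r : ℤ) ^ 2 - D →
            ∀ hI : Ideal.span {(p : 𝓞 F), (r : 𝓞 F) + α} ∈ (Ideal (𝓞 F))⁰,
              encodeNat (if orderOf (ClassGroup.mk0 ⟨_, hI⟩) = 3 then 1
                else orderOf (ClassGroup.mk0 ⟨_, hI⟩)) <+: y}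

/-- **As typed, K3 cannot tell order `3` from order `1`**: every witness family of `K3Typed` is a
witness of `K3Collapsed` (`IsQSolvable.mono`). [folklore] -/
theorem K3Collapsed_of_K3Typed (h : K3Typed) : K3Collapsed :=
  h.mono fun _ _ hy F _ _ D p r α hx hsf h2 hrank hα hp hdiv hI =>
    (encodeNat_collapse_isPrefix _).trans (hy F D p r α hx hsf h2 hrank hα hp hdiv hI)

/-- PROPOSED self-delimited form of K3 (tree's `_delim` convention). [this work: proposed signature] -/
def K3Delim : Prop :=
  IsQSolvable fun x : List Bool =>
    {y | ∀ (F : Type) [Field F] [NumberField F] (D p r : ℕ) (α : 𝓞 F),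
      x = boolPair (encodeNat D) (boolPair (encodeNat p) (encodeNat r)) →
        Squarefree D → 2 ≤ D → Module.finrank ℚ F = 2 → (α : F) ^ 2 = (D : F) → p.Prime →
          (p : ℤ) ∣ (r : ℤ) ^ 2 - D →
            ∀ hI : Ideal.span {(p : 𝓞 F), (r : 𝓞 F) + α} ∈ (Ideal (𝓞 F))⁰,
              ∃ w : List Bool, y = boolPair (encodeNat (orderOf (ClassGroup.mk0 ⟨_, hI⟩))) w}

/-- PROPOSED bit form of K3 — what the mirror triple test T3 actually consumes. [this work: proposed signature] -/
def K3Bit : Prop :=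
  IsQSolvable fun x : List Bool =>
    {y | ∀ (F : Type) [Field F] [NumberField F] (D p r : ℕ) (α : 𝓞 F),
      x = boolPair (encodeNat D) (boolPair (encodeNat p) (encodeNat r)) →
        Squarefree D → 2 ≤ D → Module.finrank ℚ F = 2 → (α : F) ^ 2 = (D : F) → p.Prime →
          (p : ℤ) ∣ (r : ℤ) ^ 2 - D →
            ∀ hI : Ideal.span {(p : 𝓞 F), (r : 𝓞 F) + α} ∈ (Ideal (𝓞 F))⁰,
              [decide (3 ∣ orderOf (ClassGroup.mk0 ⟨_, hI⟩))] <+: y}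

/-- The self-delimited form yields the bit form (classical wrap with the `[3 ∣ ·]` post-processor,
`isQSolvable_classicalWrap_holds`). [folklore] -/
theorem K3Bit_of_K3Delim (h : K3Delim) : K3Bit := by
  have hwrap := isQSolvable_classicalWrap_holds (fun x => x)
    (isNilFn ∘ remFn ∘ fanoutFn (fstF ∘ sndF) (fun _ => encodeNat 3))
    (PolyTimeComputable.id _) threeDvdPost_mem_FP h
  refine hwrap.mono fun x z hz => ?_
  simp only [Set.mem_setOf_eq] at hz ⊢
  obtain ⟨y, hy, hpre⟩ := hz
  intro F _ _ D p r α hx hsf h2 hrank hα hp hdiv hI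
  obtain ⟨w, rfl⟩ := hy F D p r α hx hsf h2 hrank hα hp hdiv hI
  rwa [threeDvdPost_apply] at hpre

end SearchOutputPrefix

/-! ### §7 (cycle 2) Line-level notes for the merged mirror line (prose; provers / lead read this)

(a) K2 `IndexThreeRelativeEscape` — sanity numerics (`k2_ratio.py` in the refuter folder, pure Python,
4 s): for the sixteen fields with `h(−d) = 3` (`d = 23, 31, 59, 83, 107, 139, 211, 283, 307, 331, 379,
499, 547, 643, 883, 907`; unique index-3 subgroup `M = 1`) the fraction of split primes `p ≤ x` whose
prime form is NON-principal is

| `x`    | range over the 16 fields |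
|--------|--------------------------|
| `10³`  | `0.684 – 0.725`          |
| `10⁴`  | `0.667 – 0.688`          |
| `10⁵`  | `0.667 – 0.675`          |
| `10⁶`  | `0.6667 – 0.6682`        |

— convergence to `2/3` from ABOVE (Chebyshev bias: the identity class of `S₃` has more square roots,
so principal primes are deficient), always `≥ 5/9`. Evidence, not proof (`∃ C` is not finitely
falsifiable); consistent with `d = 547` of §4bis (least split prime `11`, form `(11, 5, 13)` non-principal:
T2 fires at once).

(b) Load-bearing map of `MirrorDodgeLine : K2 → K1 → K1₃ → K3 → IqThreeMemBQP` (+ in-sketch PROVED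
Landau, in-tree PROVED regulator / unit residue / factoring): K1 (refined Scholz), K3 (real-side order)
and the bright-side abundance K4 matter ONLY on dark inputs (`χ_{−d}` with a real zero in Landau's
window), which cannot be exhibited (none is known; under GRH none exists) — so NO `_false_without_Kᵢ`
theorem can be written for them, and the line minus {K1, K3, K4} proves exactly the promise statement
"IQ3 restricted to bright `d` is in PromiseBQP" (torsion-witness-sampling's standalone claim). K2 is
used on every input. Nothing here is refutable; the risk is formal size (K1 needs class field theory
⇒ vendored fact; K3 a 2-dim continuous HSP ⇒ vendored fact, to be typed SELF-DELIMITED per §6).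

(c) Glue checklist for the final assembly in the tree's model (beyond §0/§1: reject `[]` and
non-canonical words — `x` canonical iff `x = []` or `x` ends in `true`; in tree: `IsCanonicalNum`,
`StackArith.encodeNat_canonical`, `TautCertificates.encodeNat_decodeNat`, `ShorOrdPost.encodeNat_decodeNat_eq_canonBits`;
acceptance on wire `0`; amplification `BQP_eq_BQPWith_holds`): the decision needs TWO quantum subroutines per input
(fundamentality of `−d` via `isQSolvable_factoring_holds` — self-delimited list output, fine — AND a
class-number / order primitive). `isQSolvable_classicalWrap_holds` makes ONE call with `FP` pre/post;
`IsQSolvable.paritySum` offers two relations to one wrapper but still one call per run;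
`isQSolvable_of_mem_FPRel_BQP_holds` / `isQSolvable_of_generated_oracle_circuits` take LANGUAGE oracles
in `BQP`. So the cheapest assembly is: (i) make the class-number / order primitive a TOTAL bit relation
(§6 `threeDvdBit_total_of_total`) ⇒ language `L₃ = {x | 3 ∣ h(−decodeNat x)} ∈ BQP` by
`mem_BQP_of_isQSolvable_bit`; (ii) `FUND = {x | IsNegFundamentalDiscr (decodeNat x)} ∈ BQP` from
`isQSolvable_factoring_holds` by one classical wrap (square-freeness and the congruences are `FP` in the
factor list); (iii) `IQ3 = CANON ∩ FUND ∩ L₃` with `CANON ∈ P` — needs closure of `BQP` under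
intersection with a `BQP` language, which I did not find in the tree as a NAMED theorem
(`lean search` for `inter_mem_BQP|BQP_inter|…`: no hit; `co_BQP_holds`, `BQP_eq_BQPWith_holds` exist) but
which is DERIVABLE from proved pieces: `isQSolvable_of_mem_FPRel_BQP_holds` (an `FP` oracle machine
with coins relative to ONE `BQP` language `A` solves an extension-closed relation ⇒ `IsQSolvable`;
BBBV Cor. 4.15) with `A :=` the parity-sum join of `L₃` and `FUND` (language-level twin of
`QCircuitFamily.paritySum`, whose kernel lemmas are proved) and a two-query oracle machine, then
`mem_BQP_of_isQSolvable_bit`. ONE small combinator to write, shared with every line of this crux and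
with DarkClassGroups.

(d) No kill of any typed first lemma of the five cards (triage panel r1: 3 × pass-all). My own checks:
`ScholzMirrorCriterion` hand instances `d = 23` (`ε_69 = (25 + 3√69)/2`, `3 ∣ b`, `h(−23) = 3` ✓),
`d = 8, 20` (not primary, `h = 1, 2` ✓), `d = 15` for `ScholzMirrorCriterion₃` (`z = 1 + √5`,
`z⁸ = 6016 + 2688√5`, `9 ∣ 6016 − 256` but `9 ∤ 2688` ⇒ not primary; `h(ℚ(√5)) = 1`; `h(−15) = 2` ✓);
`IsFundUnitPair (3·kernel d)` is satisfiable and forces `a, b` even when `3m ≢ 1 (mod 4)` (parity check),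
so "`3 ∣ b`" is the right primarity bit in both sub-cases; `IndexThreeRelativeEscape_of_TZ` is derivable
from the vendored `ThornerZaman2019_classPNT_hilbertClassField` AS TYPED (dark branch: multiplicative
error relative to the `χ₁`-corrected main term for EVERY class `C`; with `Σ_{C∈M} χ₁(C) = 0` for
`χ₁ ≠ 1` — `restrict_ne_one_of_index_three`, proved in the sketch — and all corrected main terms
`≥ 0`, the class sums inside/outside `M` are `(1/3, 2/3)·Li x·(1 ± E)`; for `χ₁ = 1` both sides scale by
`Li x − Li x^{β₁}`); `ThornerZaman.condQn K ≥ 4·23` on the fields that have an index-3 subgroup, so the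
`x`-range hypothesis is not vacuous/junk. The mathematics of the line stands; §6 is about its typing.
-/


end Summit.QuantumAdvantage.QuantumAdvantage.Cruxes.IqThreeMemBQP.Disproof

end
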